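import Mathlib
import HarnessLib
import Summits.ResolutionOfSingularities.ResolutionOfSingularities.Theorems.WildQuotientsWildQuotientResolutionS1aAuxOrbit

/-!
# S1a — BOUNDED ONE-ORBIT AUX SEQUENCES `AuxOrbitWithin n`, the research statement `AuxWithinReach p`, and the winning induction on `(jInf, topCount, n, nIrrComp Z)`

[OURS · L1 W4.5c · lead-1 g9] — NOT statements of the manuscript; counted 0; AI-level work, weaker than expert review. Crux
stmt-ResolutionOfSingularities-17941, line `s1a-logminvertex` v9 (lead reshape of the A stub). Route-independent.

* `GameFrame.GModel.AuxOrbitWithin n M` — `n = 0`: `AuxOrbitAt M` (`…S1aAuxOrbit`); `n + 1`: that, or an AUX-admissible centre along EVERY move of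
  which `(jInf, topCount)` does NOT increase lexicographically and the moved model satisfies `AuxOrbitWithin n`;
* **`AuxWithinReach p`** (OURS CANDIDATE research statement, asserted nowhere): at every reachable non-terminal model with `jInf ≠ ⊥`,
  `(∃ n, AuxTopWithin n M) ∨ (∃ n, AuxOrbitWithin n M)` — WEAKER than the registered v7/v8 stub `AuxTopWithinReach p` by `Or.inl`
  (`auxWithinReach_of_auxTopWithinReach`); the second disjunct handles ONE `G`-orbit of top non-killable components at a time;
* ★★ `GameFrame.GModel.wins_of_touchOrTopOrOrbitSeq` — the nested induction: strong induction on a bound for `jInf`; inside, induction on a bound for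
  `topCount`; inside, the three branches — TOUCH-KILL at `jInf = ⊥` (induction on `nIrrComp badLocus`, `…S1aKillTouch`), bounded `AuxAltWithin`
  sequences (end in a `jInf` drop), bounded `AuxOrbitWithin` sequences (end in a lexicographic `(jInf, topCount)` drop).
The `Theses`-cone wrapper (`KillTouchReach p → AuxWithinReach p → WinningStrategy p`) is `…S1aWinsOfOrbitRule`.
-/

set_option linter.dupNamespace false

noncomputable section

open CategoryTheory Limits AlgebraicGeometry TopologicalSpace Topology
open Literature.AlgebraicGeometry.Resolution Literature.AlgebraicGeometry.RelativeSpec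
open Summit.ResolutionOfSingularities.ResolutionOfSingularities.Theorems.WildQuotientResolution.S1
open Summit.ResolutionOfSingularities.ResolutionOfSingularities.Theorems.WildQuotientResolution.S1.NodeAtlas
open Summit.ResolutionOfSingularities.ResolutionOfSingularities.Theorems.WildQuotientResolution.S1.G1Proof
open Summit.ResolutionOfSingularities.ResolutionOfSingularities.Theorems.WildQuotientResolution.S1.CompCount
open Summit.ResolutionOfSingularities.ResolutionOfSingularities.Theorems.WildQuotientResolution.S1.TopComponents

namespace Summit.ResolutionOfSingularities.ResolutionOfSingularities.Theorems.WildQuotientResolution.S1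

namespace GameFrame.GModel

variable {p : ℕ} {X' X₁ : Scheme.{0}} {q : X' ⟶ X₁} {G : Type} [Group G] {ρ : G →* Aut X'} {g₀ : G}

/-- **`AuxOrbitWithin n M`** (OURS CANDIDATE research statement, asserted nowhere; the one-orbit analogue of `AuxTopWithin`): `(jInf, topCount)` drops
lexicographically after AT MOST `n + 1` AUX moves — `n = 0`: `AuxOrbitAt M`; `n + 1`: either `AuxOrbitAt M`, or there is an AUX-admissible centre `(𝒦, d)`
such that along EVERY move of it `(jInf, topCount)` does NOT increase lexicographically and the moved model satisfies `AuxOrbitWithin n`.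
[OURS · L1 W4.5c] -/
def AuxOrbitWithin : ℕ → GModel p q G ρ g₀ → Prop
  | 0, M => M.AuxOrbitAt
  | n + 1, M => M.AuxOrbitAt ∨
      ∃ (𝒦 : ReesFiltration M.V) (d : ℕ), IsAuxCentre p M.act g₀ 𝒦 d (M.badLocus)ᶜ ∧
        ∀ M' : GModel p q G ρ g₀, M.IsMoveOf M' 𝒦 d →
          (M'.jInf < M.jInf ∨ (M'.jInf = M.jInf ∧ M'.topCount ≤ M.topCount)) ∧ AuxOrbitWithin n M'

/-- Unfolding at `0`. -/
@[simp] theorem auxOrbitWithin_zero (M : GModel p q G ρ g₀) : AuxOrbitWithin 0 M ↔ M.AuxOrbitAt := Iff.rfl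

/-- `AuxOrbitAt` is every `AuxOrbitWithin n`. -/
theorem auxOrbitWithin_of_auxOrbitAt {M : GModel p q G ρ g₀} (h : M.AuxOrbitAt) : ∀ n : ℕ, AuxOrbitWithin n M
  | 0 => h
  | _ + 1 => Or.inl h

/-- `x ≠ ⊥`, `x < n` in `WithBot ℕ∞` ⇒ `x` is a natural number. -/
theorem exists_nat_eq_of_ne_bot_of_lt {x : WithBot ℕ∞} {n : ℕ} (h1 : x ≠ ⊥) (h2 : x < n) : ∃ k : ℕ, x = k :=
  exists_nat_eq_of_ne_bot_of_le h1 h2.le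

/-! ## The winning-strategy induction with all three branches -/

/-- ★★ **TOUCH-KILL ∨ bounded AUX-TOP sequence ∨ bounded AUX-ORBIT sequence WINS.** Let `P` be a class of quasi-compact models stable under admissible
moves, with Noetherian bases and finite `ν₁`. If at every non-terminal `P`-model EITHER `jInf = ⊥` and some principal centreʼs support touches the bad
locus, OR `AuxAltWithin n M` for some `n`, OR `AuxOrbitWithin n M` for some `n`, then every `P`-model WINS. Nested induction: a bound for `jInf`
(strong), then a bound for `topCount`, then — per branch — `nIrrComp badLocus` / the sequence length. [OURS · L1 W4.5c] -/
theorem wins_of_touchOrTopOrOrbitSeq [Finite G] (hp : p.Prime) (hG : ∀ g : G, g ∈ Subgroup.zpowers g₀) (P : GModel p q G ρ g₀ → Prop)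
    (hPmove : ∀ (M M' : GModel p q G ρ g₀) (𝒦 : ReesFiltration M.V) (d : ℕ),
      P M → IsAdmissibleCentre p M.act g₀ 𝒦 d → M.IsMoveOf M' 𝒦 d → P M')
    (hB : ∀ M : GModel p q G ρ g₀, P M → M.HasNoetherianBase) (hnu : ∀ M : GModel p q G ρ g₀, P M → ∃ n : ℕ, M.nu1 < n)
    (hcpt : ∀ M : GModel p q G ρ g₀, P M → CompactSpace M.V)
    (H : ∀ M : GModel p q G ρ g₀, P M → ¬ M.Terminal →
      (M.jInf = ⊥ ∧ ∃ (𝒦 : ReesFiltration M.V) (d : ℕ), IsPrincipalCentre p M.act g₀ 𝒦 d ∧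
        (M.badLocus ∩ ((𝒦.ideal d).support : Set M.V)).Nonempty) ∨
      (∃ n : ℕ, AuxAltWithin n M) ∨ (∃ n : ℕ, AuxOrbitWithin n M))
    (M₀ : GModel p q G ρ g₀) (hP₀ : P M₀) : Wins p q G ρ g₀ M₀ := by
  have hfin : ∀ M : GModel p q G ρ g₀, P M → (irreducibleComponents ↥M.badLocus).Finite := fun M hPM => by
    haveI := hcpt M hPM
    exact M.finite_irreducibleComponents_badLocus
  obtain ⟨n₀, hn₀⟩ := hnu M₀ hP₀
  suffices main : ∀ (a : ℕ) (M : GModel p q G ρ g₀), P M → M.jInf < a → Wins p q G ρ g₀ M from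
    main n₀ M₀ hP₀ (lt_of_le_of_lt M₀.jInf_le_nu1 hn₀)
  intro a
  induction a using Nat.strong_induction_on with
  | _ a iha =>
    -- strict `jInf` drops are handled by the outer hypothesis
    have drop : ∀ M M' : GModel p q G ρ g₀, P M' → M.jInf < a → M'.jInf < M.jInf → Wins p q G ρ g₀ M' := fun M M' hP' ha hj => by
      cases a with
      | zero => exact absurd (withBot_eq_bot_of_lt_zero ha ▸ hj) not_lt_bot
      | succ a' => exact iha a' (Nat.lt_succ_self a') M' hP' (lt_of_lt_of_le hj (withBot_le_of_lt_succ ha))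
    -- bounded AUX-TOP sequences, by induction on their length (end in a `jInf` drop)
    have seqTop : ∀ (n : ℕ) (M : GModel p q G ρ g₀), P M → M.jInf < a → AuxAltWithin n M → Wins p q G ρ g₀ M := by
      intro n
      induction n with
      | zero =>
        intro M hPM ha h
        obtain ⟨𝒦, d, haux, hmoves⟩ := h
        exact Wins.of_moves 𝒦 d haux.1 fun M' hmv => drop M M' (hPmove M M' 𝒦 d hPM haux.1 hmv) ha (hmoves M' hmv)
      | succ n ihn =>
        intro M hPM ha h
        rcases h with h | ⟨𝒦, d, haux, hmoves⟩
        · obtain ⟨𝒦, d, haux, hmoves⟩ := h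
          exact Wins.of_moves 𝒦 d haux.1 fun M' hmv => drop M M' (hPmove M M' 𝒦 d hPM haux.1 hmv) ha (hmoves M' hmv)
        · exact Wins.of_moves 𝒦 d haux.1 fun M' hmv =>
            ihn M' (hPmove M M' 𝒦 d hPM haux.1 hmv) (lt_of_le_of_lt (hmoves M' hmv).1 ha) (hmoves M' hmv).2
    -- induction on a bound for `topCount`
    have level : ∀ (b : ℕ) (M : GModel p q G ρ g₀), P M → M.jInf < a → M.topCount < b → Wins p q G ρ g₀ M := by
      intro b
      induction b with
      | zero => exact fun M _ _ hb => absurd hb (Nat.not_lt_zero _)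
      | succ b ihb =>
        -- one AUX-ORBIT move from a model with `topCount ≤ b`
        have orbAt : ∀ M : GModel p q G ρ g₀, P M → M.jInf < a → M.topCount ≤ b → M.AuxOrbitAt → Wins p q G ρ g₀ M := by
          intro M hPM ha hb h
          haveI := hcpt M hPM
          -- `jInf M` is a natural number (it is `≠ ⊥`: a top component exists; and `< a`)
          have hne : M.jInf ≠ ⊥ := by
            obtain ⟨-, -, -, ⟨t, ht, -, -⟩, -⟩ := h
            intro hbot
            rw [jInf, topologicalKrullDim, Order.krullDim_eq_bot_iff] at hbot
            obtain ⟨x, -⟩ := ht.1.nonempty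
            exact hbot.elim ⟨closure {x}, isIrreducible_singleton.closure, isClosed_closure⟩
          obtain ⟨k, hk⟩ := exists_nat_eq_of_ne_bot_of_lt hne ha
          obtain ⟨𝒦, d, haux, hmoves⟩ := lex_lt_of_move_of_auxOrbitAt hp hG M (hB M hPM) hk h
          refine Wins.of_moves 𝒦 d haux.1 fun M' hmv => ?_
          have hPM' := hPmove M M' 𝒦 d hPM haux.1 hmv
          rcases hmoves M' hmv with hlt | ⟨heq, hlt⟩
          · exact drop M M' hPM' ha hlt
          · exact ihb M' hPM' (heq ▸ ha) (lt_of_lt_of_le hlt hb)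
        -- bounded AUX-ORBIT sequences from models with `topCount ≤ b`, by induction on their length
        have seqOrb : ∀ (n : ℕ) (M : GModel p q G ρ g₀), P M → M.jInf < a → M.topCount ≤ b → AuxOrbitWithin n M → Wins p q G ρ g₀ M := by
          intro n
          induction n with
          | zero => exact fun M hPM ha hb h => orbAt M hPM ha hb h
          | succ n ihn =>
            intro M hPM ha hb h
            rcases h with h | ⟨𝒦, d, haux, hmoves⟩
            · exact orbAt M hPM ha hb h
            · refine Wins.of_moves 𝒦 d haux.1 fun M' hmv => ?_
              have hPM' := hPmove M M' 𝒦 d hPM haux.1 hmv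
              obtain ⟨hlex, hwithin⟩ := hmoves M' hmv
              rcases hlex with hlt | ⟨heq, hle⟩
              · exact drop M M' hPM' ha hlt
              · exact ihn M' hPM' (heq ▸ ha) (hle.trans hb) hwithin
        -- TOUCH-KILL moves at `jInf = ⊥`: induction on a bound for `nIrrComp badLocus`
        have kill : ∀ (c : ℕ) (M : GModel p q G ρ g₀), P M → M.jInf < a → M.topCount ≤ b → nIrrComp ↥M.badLocus < c →
            Wins p q G ρ g₀ M := by
          intro c
          induction c with
          | zero => exact fun M _ _ _ hc => absurd hc (Nat.not_lt_zero _)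
          | succ c ihc =>
            intro M hPM ha hb hc
            by_cases hT : M.Terminal
            · exact Wins.terminal M hT
            rcases H M hPM hT with ⟨hbot, 𝒦, d, hprin, htouch⟩ | ⟨n, hn⟩ | ⟨n, hn⟩
            · refine Wins.of_moves 𝒦 d (isAdmissibleCentre_of_isPrincipalCentre hprin) fun M' hmv => ?_
              have hPM' := hPmove M M' 𝒦 d hPM (isAdmissibleCentre_of_isPrincipalCentre hprin) hmv
              have hj : M'.jInf ≤ M.jInf := jInf_move_le hp hG M M' 𝒦 d hprin (hB M hPM) hmv
              have hbot' : M'.jInf = ⊥ := le_bot_iff.mp (hbot ▸ hj)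
              exact ihc M' hPM' (lt_of_le_of_lt hj ha) (by rw [M'.topCount_eq_zero_of_jInf_eq_bot hbot']; exact Nat.zero_le _)
                (lt_of_lt_of_le (nIrrComp_badLocus_principalMove_lt hp hG M M' 𝒦 d hprin (hB M hPM) (hfin M hPM) htouch hmv)
                  (Nat.lt_succ_iff.mp hc))
            · exact seqTop n M hPM ha hn
            · exact seqOrb n M hPM ha hb hn
        intro M hPM ha hb
        exact kill (nIrrComp ↥M.badLocus + 1) M hPM ha (Nat.lt_succ_iff.mp hb) (Nat.lt_succ_self _)
    intro M hPM ha
    exact level (M.topCount + 1) M hPM ha (Nat.lt_succ_self _)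

end GameFrame.GModel

/-! ## The A-side research statement with the one-orbit alternative -/

/-- **`AuxWithinReach p`** (OURS CANDIDATE research statement, asserted nowhere; lead-1 g9): at every non-terminal model reachable from the initial model
of a crux datum with a non-killable bad point (`jInf ≠ ⊥`), EITHER `∃ n, AuxTopWithin n M` (the registered v7/v8 statement `AuxTopWithinReach`, verbatim:
a bounded aux sequence with `jInf` non-increasing ending where ONE aux centre contains ALL top non-killable components in its support and makes the bad
points over it killable) OR `∃ n, AuxOrbitWithin n M` (the ONE-ORBIT alternative: a bounded aux sequence with `(jInf, topCount)` lexicographically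
non-increasing ending where an aux centre contains SOME top non-killable component in its support and makes the bad points over it killable). Weaker than
`AuxTopWithinReach p` by `Or.inl`. WHY THE SECOND DISJUNCT: top non-killable components that MEET (F-TRI4) or need different recipes can be treated one
`G`-orbit at a time; its price: intermediate moves must not raise the number of top components. [OURS · L1 W4.5c] -/
def AuxWithinReach (p : ℕ) : Prop :=
  ∀ (k : Type) [Field k] [CharP k p] [PerfectField k] (X' X₁ : Scheme.{0})
    (f : X₁ ⟶ Spec (.of k)) (q : X' ⟶ X₁) (G : Type) [Group G] [Finite G]
    (ρ : G →* Aut X'), Nat.card G = p → IsSeparated f → LocallyOfFiniteType f → QuasiCompact f →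
    IsIntegral X₁ → ∀ [IsIntegral X'], Scheme.IsRegular X' → IsFinite q → Function.Surjective q.base →
    (∃ U : X₁.Opens, Dense (U : Set X₁) ∧ Etale (q ∣_ U)) →
    ∀ (hq : ∀ g : G, (ρ g).hom ≫ q = q),
    (∀ x y : X', q.base x = q.base y → ∃ g : G, (ρ g).hom.base x = y) →
    topologicalKrullDim X₁ ≤ 4 → Function.Injective ρ →
    ∀ (g₀ : G), (∀ g : G, g ∈ Subgroup.zpowers g₀) → ∀ [IsLocallyNoetherian X']
      (h₀ : NodeAtlas p (⟨ρ, hq⟩ : ActionOver q G) g₀),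
      ∀ M : GameFrame.GModel p q G ρ g₀, (GameFrame.GModel.initial hq h₀).Reachable M → ¬ M.Terminal →
        M.jInf ≠ ⊥ → (∃ n : ℕ, GameFrame.GModel.AuxTopWithin n M) ∨ (∃ n : ℕ, GameFrame.GModel.AuxOrbitWithin n M)

/-- **The registered A stub implies the new one**: `AuxTopWithinReach p ⇒ AuxWithinReach p` (`Or.inl`). [OURS · L1 W4.5c] -/
theorem auxWithinReach_of_auxTopWithinReach {p : ℕ} (h : AuxTopWithinReach p) : AuxWithinReach p := by
  intro k _ _ _ X' X₁ f q G _ _ ρ hG hfs hflft hfqc hX₁ _ hreg hqfin hqsurj hU hq horb hdim hinj g₀ hg₀ _ h₀ M hM hT hj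
  exact Or.inl (h k X' X₁ f q G ρ hG hfs hflft hfqc hX₁ hreg hqfin hqsurj hU hq horb hdim hinj g₀ hg₀ h₀ M hM hT hj)

/-- **The pure one-orbit form implies the new statement** (`Or.inr`). [OURS · L1 W4.5c] -/
theorem auxWithinReach_of_orbit {p : ℕ}
    (h : ∀ (k : Type) [Field k] [CharP k p] [PerfectField k] (X' X₁ : Scheme.{0})
      (f : X₁ ⟶ Spec (.of k)) (q : X' ⟶ X₁) (G : Type) [Group G] [Finite G]
      (ρ : G →* Aut X'), Nat.card G = p → IsSeparated f → LocallyOfFiniteType f → QuasiCompact f →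
      IsIntegral X₁ → ∀ [IsIntegral X'], Scheme.IsRegular X' → IsFinite q → Function.Surjective q.base →
      (∃ U : X₁.Opens, Dense (U : Set X₁) ∧ Etale (q ∣_ U)) →
      ∀ (hq : ∀ g : G, (ρ g).hom ≫ q = q),
      (∀ x y : X', q.base x = q.base y → ∃ g : G, (ρ g).hom.base x = y) →
      topologicalKrullDim X₁ ≤ 4 → Function.Injective ρ →
      ∀ (g₀ : G), (∀ g : G, g ∈ Subgroup.zpowers g₀) → ∀ [IsLocallyNoetherian X']
        (h₀ : NodeAtlas p (⟨ρ, hq⟩ : ActionOver q G) g₀),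
        ∀ M : GameFrame.GModel p q G ρ g₀, (GameFrame.GModel.initial hq h₀).Reachable M → ¬ M.Terminal →
          M.jInf ≠ ⊥ → ∃ n : ℕ, GameFrame.GModel.AuxOrbitWithin n M) :
    AuxWithinReach p := by
  intro k _ _ _ X' X₁ f q G _ _ ρ hG hfs hflft hfqc hX₁ _ hreg hqfin hqsurj hU hq horb hdim hinj g₀ hg₀ _ h₀ M hM hT hj
  exact Or.inr (h k X' X₁ f q G ρ hG hfs hflft hfqc hX₁ hreg hqfin hqsurj hU hq horb hdim hinj g₀ hg₀ h₀ M hM hT hj)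

end Summit.ResolutionOfSingularities.ResolutionOfSingularities.Theorems.WildQuotientResolution.S1

end
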